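import Mathlib.Analysis.InnerProductSpace.Basic
import Literature.MathematicalPhysics.QuantumFieldTheory.Balaban1983to89.B4Eq19LatticeCaccioppoli
import HarnessLib

/-!
# Line «poincare_lipschitz» on crux `HistoryTailL` (stmt-QuantumFields-19936), route crux `BlockLipschitzL` (stmt-QuantumFields-23533), K2 supplier plan,
# (R3)-COV brick (a) — THE COVARIANT CACCIOPPOLI INEQUALITY ON `ℤ^d`, GENUINELY COVARIANT: for a connection by LINEAR ISOMETRIES of a real inner-product
# space and `(Σ_μ D*_μD_μ + κ)u = Σ_μ D*_μ g_μ` on `Q_{ρ+s}(z)`: `Σ_{Q_ρ} Σ_μ ‖D_μu‖² ≤ (14d∕s²)·Σ_{Q_{ρ+s+2}} ‖u‖² + 4·Σ_{Q_{ρ+s+1}} Σ_μ ‖g_μ‖²` —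
# the FLAT constants of ✓`B4Eq19LatticeCaccioppoli.caccioppoli`, NO smallness of the connection

Cell `ym3-torus` (YM ladder rung R3 = continuum SU(2) Yang–Mills on the three-torus — a RUNG, NOT the Clay problem: not d = 4, not infinite volume, not a
mass gap); width seat `ym3-torus-px7` gen 4 on LEAD ym-ust-19936-w1 g7's pen «COV-CACCIOPPOLI → px7» (2026-08-29T01:03:24Z; card v1.29 (a)).  THEOREMS ONLY
(def-free); `--supports stmt-QuantumFields-23533`.  Nothing here proves the (R3)-COV row, `hStab`, F5/F6, a stub, `BlockLipschitzL`, `HistoryTailL` or a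
summit statement.

WHY (card v1.28/v1.29).  F6 lands conditional on ONE displayed covariant interior-regularity row; its concrete supplier is the covariant Campanato road,
whose first brick is Caccioppoli.  As located on the bus (01:01Z, adopted 01:03Z): NO perturbation in the background is needed — the flat proof goes through
VERBATIM once products become inner products, because (i) a REAL scalar cut-off `χ` commutes with the transports (exact covariant Leibniz
`D_μ(χ²u)(y) = χ(y+e_μ)²·D_μu(y) + (χ(y+e_μ)+χ(y))(χ(y+e_μ)−χ(y))·u(y)`), and (ii) the transports are ISOMETRIES (`⟪τa, τb⟫ = ⟪a, b⟫`, `‖τa‖ = ‖a‖`), so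
`D*_μ` is the exact adjoint of `D_μ` and every Cauchy–Schwarz∕Young step of ✓`pointwise_young` survives with the same numbers.

SETTING (abstract; def-free, the operators are written out).  `V` a real inner-product space; a CONNECTION `τ : Fin d → ℤ^d → (V ≃ₗᵢ[ℝ] V)`, `τ μ y` the
transport from the fibre at `y + e_μ` to the fibre at `y`; covariant forward difference `D_μu(y) := τ μ y (u(y+e_μ)) − u(y)`; its adjoint
`D*_μG(y) := (τ μ (y−e_μ))⁻¹ (G(y−e_μ)) − G(y)`; the equation `(Σ_μ D*_μD_μ + κ)u = Σ_μ D*_μ g_μ` reads, expanded,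
`Σ_μ (2u(y) − (τ μ (y−e_μ))⁻¹u(y−e_μ) − τ μ y u(y+e_μ)) + κ·u(y) = Σ_μ ((τ μ (y−e_μ))⁻¹ g_μ(y−e_μ) − g_μ(y))`.
INSTANCE OF RECORD (w5-19936 g10 00:59:21Z, LEAD 01:03:24Z): `V = M_n(ℂ)` with the Frobenius (Hilbert–Schmidt) real inner product `re tr(X*Y)`, `τ μ y = Ad(U_μ(y))`
(`B9Eq39Adjoint.R`, `R U X = U X U⁻¹`, unitary `U` ⇒ a linear isometry); then `D_μ = B9Eq39Adjoint.covD`, `D*_μ = covDstar` on `ℤ^d` boxes pulled back along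
`B10Eq27TorusAxialLog.transl` exactly as the flat torus files do.  (The 20-line bridge is the consumer's; this file is carrier-free.)

* §1 `sum_inner_covLop`, `sum_inner_covDvg` — covariant summation by parts on boxes (test function vanishing off `Q_{R−1}(z)`; twins of
  ✓`B4Eq19LatticeOperators.sum_mul_lop`∕`sum_mul_dvg`).
* §2 `scalar_young` — the Young∕Cauchy–Schwarz bookkeeping of ✓`pointwise_young` with inner products abstracted to reals.
* §3 ★★ `cov_caccioppoli` — the title; ★ `cov_caccioppoli_harmonic` (`g = 0`).
[folklore] ([Giaquinta1984] Ch. III §2 (2.3)–(2.4) p.77 with a metric connection; [Balaban1984PropagatorsII] (1.9) p.226 is the print locus of the flat constants).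
-/

set_option autoImplicit false

noncomputable section

open scoped BigOperators InnerProductSpace
open Finset

namespace Summit.QuantumFields.YangMills.Theorems.PoincareLipschitzCovariantCaccioppoli

open Literature.MathematicalPhysics.QuantumFieldTheory.Balaban1983to89
open B4Eq19LatticeOperators
open B4Eq19LatticeCaccioppoli (exists_cutoff)

variable {d : ℕ} {V : Type*} [NormedAddCommGroup V] [InnerProductSpace ℝ V]

/-! ## §1 Covariant summation by parts on boxes -/

/-- **COVARIANT SUMMATION BY PARTS for `Σ_μ D*_μD_μ + κ`**: for a test function `φ` vanishing off `Q_{R−1}(z)`,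
`Σ_{Q_R} ⟪φ, (Σ_μ D*_μD_μ + κ)u⟫ = Σ_{Q_R} Σ_μ ⟪D_μφ, D_μu⟫ + κ·Σ_{Q_R} ⟪φ, u⟫` (isometric transports). [folklore] [cite: Giaquinta1984, Ch. III §2 (2.3) p.77] -/
theorem sum_inner_covLop (τ : Fin d → Zd d → (V ≃ₗᵢ[ℝ] V)) (κ : ℝ) (φ u : Zd d → V) (z : Zd d) (R : ℤ)
    (hφ : ∀ y ∉ box z (R - 1), φ y = 0) :
    ∑ y ∈ box z R, ⟪φ y, (∑ μ, ((u y + u y) - (τ μ (y - unitVec μ)).symm (u (y - unitVec μ)) - τ μ y (u (y + unitVec μ)))) + κ • u y⟫_ℝ =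
      (∑ y ∈ box z R, ∑ μ, ⟪τ μ y (φ (y + unitVec μ)) - φ y, τ μ y (u (y + unitVec μ)) - u y⟫_ℝ) + κ * ∑ y ∈ box z R, ⟪φ y, u y⟫_ℝ := by
  -- the backward term, transported and shifted
  have key : ∀ μ : Fin d, ∑ y ∈ box z R, ⟪φ y, u y - (τ μ (y - unitVec μ)).symm (u (y - unitVec μ))⟫_ℝ =
      ∑ y ∈ box z R, ⟪τ μ y (φ (y + unitVec μ)), τ μ y (u (y + unitVec μ)) - u y⟫_ℝ := by
    intro μ
    have h := sum_box_shift_of_support (F := fun y => ⟪φ y, u y - (τ μ (y - unitVec μ)).symm (u (y - unitVec μ))⟫_ℝ) (z := z) (R := R)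
      (fun y hy => by simp only [hφ y hy, inner_zero_left]) (unitVec μ) (abs_unitVec_apply_le μ)
    simp only [add_sub_cancel_right] at h
    rw [← h]
    refine Finset.sum_congr rfl fun y _ => ?_
    rw [← (τ μ y).inner_map_map (φ (y + unitVec μ)) _, map_sub, LinearIsometryEquiv.apply_symm_apply]
  calc ∑ y ∈ box z R, ⟪φ y, (∑ μ, ((u y + u y) - (τ μ (y - unitVec μ)).symm (u (y - unitVec μ)) - τ μ y (u (y + unitVec μ)))) + κ • u y⟫_ℝ
      = ∑ y ∈ box z R, ((∑ μ, (⟪φ y, u y - (τ μ (y - unitVec μ)).symm (u (y - unitVec μ))⟫_ℝ - ⟪φ y, τ μ y (u (y + unitVec μ)) - u y⟫_ℝ)) +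
          κ * ⟪φ y, u y⟫_ℝ) := by
        refine Finset.sum_congr rfl fun y _ => ?_
        rw [inner_add_right, inner_sum, real_inner_smul_right]
        congr 1
        refine Finset.sum_congr rfl fun μ _ => ?_
        rw [← inner_sub_right]
        congr 1
        abel
    _ = (∑ μ, ((∑ y ∈ box z R, ⟪φ y, u y - (τ μ (y - unitVec μ)).symm (u (y - unitVec μ))⟫_ℝ) -
          ∑ y ∈ box z R, ⟪φ y, τ μ y (u (y + unitVec μ)) - u y⟫_ℝ)) + κ * ∑ y ∈ box z R, ⟪φ y, u y⟫_ℝ := by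
        rw [Finset.sum_add_distrib, Finset.sum_comm, ← Finset.mul_sum]
        congr 1
        exact Finset.sum_congr rfl fun μ _ => Finset.sum_sub_distrib _ _
    _ = (∑ μ, ∑ y ∈ box z R, ⟪τ μ y (φ (y + unitVec μ)) - φ y, τ μ y (u (y + unitVec μ)) - u y⟫_ℝ) + κ * ∑ y ∈ box z R, ⟪φ y, u y⟫_ℝ := by
        congr 1
        refine Finset.sum_congr rfl fun μ _ => ?_
        rw [key μ, ← Finset.sum_sub_distrib]
        refine Finset.sum_congr rfl fun y _ => ?_
        rw [inner_sub_left]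
    _ = _ := by rw [Finset.sum_comm]

/-- **COVARIANT SUMMATION BY PARTS for the adjoint**: `Σ_{Q_R} ⟪φ, Σ_μ D*_μ g_μ⟫ = Σ_{Q_R} Σ_μ ⟪D_μφ, g_μ⟫` for `φ` vanishing off `Q_{R−1}(z)`. [folklore]
[cite: Balaban1985BackgroundPropagators, (3.8) p.392] -/
theorem sum_inner_covDvg (τ : Fin d → Zd d → (V ≃ₗᵢ[ℝ] V)) (φ : Zd d → V) (g : Zd d → Fin d → V) (z : Zd d) (R : ℤ)
    (hφ : ∀ y ∉ box z (R - 1), φ y = 0) :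
    ∑ y ∈ box z R, ⟪φ y, ∑ μ, ((τ μ (y - unitVec μ)).symm (g (y - unitVec μ) μ) - g y μ)⟫_ℝ =
      ∑ y ∈ box z R, ∑ μ, ⟪τ μ y (φ (y + unitVec μ)) - φ y, g y μ⟫_ℝ := by
  have key : ∀ μ : Fin d, ∑ y ∈ box z R, ⟪φ y, (τ μ (y - unitVec μ)).symm (g (y - unitVec μ) μ)⟫_ℝ =
      ∑ y ∈ box z R, ⟪τ μ y (φ (y + unitVec μ)), g y μ⟫_ℝ := by
    intro μ
    have h := sum_box_shift_of_support (F := fun y => ⟪φ y, (τ μ (y - unitVec μ)).symm (g (y - unitVec μ) μ)⟫_ℝ) (z := z) (R := R)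
      (fun y hy => by simp only [hφ y hy, inner_zero_left]) (unitVec μ) (abs_unitVec_apply_le μ)
    simp only [add_sub_cancel_right] at h
    rw [← h]
    refine Finset.sum_congr rfl fun y _ => ?_
    rw [← (τ μ y).inner_map_map (φ (y + unitVec μ)) _, LinearIsometryEquiv.apply_symm_apply]
  calc ∑ y ∈ box z R, ⟪φ y, ∑ μ, ((τ μ (y - unitVec μ)).symm (g (y - unitVec μ) μ) - g y μ)⟫_ℝ
      = ∑ y ∈ box z R, ∑ μ, (⟪φ y, (τ μ (y - unitVec μ)).symm (g (y - unitVec μ) μ)⟫_ℝ - ⟪φ y, g y μ⟫_ℝ) := by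
        refine Finset.sum_congr rfl fun y _ => ?_
        rw [inner_sum]
        exact Finset.sum_congr rfl fun μ _ => inner_sub_right _ _ _
    _ = ∑ μ, ((∑ y ∈ box z R, ⟪φ y, (τ μ (y - unitVec μ)).symm (g (y - unitVec μ) μ)⟫_ℝ) - ∑ y ∈ box z R, ⟪φ y, g y μ⟫_ℝ) := by
        rw [Finset.sum_comm]
        exact Finset.sum_congr rfl fun μ _ => Finset.sum_sub_distrib _ _
    _ = ∑ μ, ∑ y ∈ box z R, ⟪τ μ y (φ (y + unitVec μ)) - φ y, g y μ⟫_ℝ := by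
        refine Finset.sum_congr rfl fun μ _ => ?_
        rw [key μ, ← Finset.sum_sub_distrib]
        refine Finset.sum_congr rfl fun y _ => ?_
        rw [inner_sub_left]
    _ = _ := Finset.sum_comm

/-! ## §2 The scalar Young∕Cauchy–Schwarz bookkeeping -/

set_option maxHeartbeats 400000 in
/-- The real-variable inequality behind the vector Caccioppoli step: with `0 ≤ χ₀, χ₁ ≤ 1`, `|χ₁ − χ₀| ≤ δ`, non-negative sizes `n₀, nD, ng` and `nw` with
`nD ≤ nw + n₀` and pairings `|P| ≤ n₀·nD`, `|Q| ≤ nD·ng`, `|S| ≤ n₀·ng`: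
`−(χ₁+χ₀)(χ₁−χ₀)P + χ₁²Q + (χ₁+χ₀)(χ₁−χ₀)S ≤ ½(χ₁nD)² + (13∕2)δ²n₀² + ½δ²nw² + 2ng²`. [folklore] [cite: Giaquinta1984, Ch. III §2 (2.4) p.77] -/
theorem scalar_young {χ₀ χ₁ δ n₀ nw nD ng P Q S : ℝ} (h0 : 0 ≤ χ₀) (h0' : χ₀ ≤ 1) (h1 : 0 ≤ χ₁) (h1' : χ₁ ≤ 1) (hδ : |χ₁ - χ₀| ≤ δ)
    (hn₀ : 0 ≤ n₀) (hnD : 0 ≤ nD) (hng : 0 ≤ ng) (hDle : nD ≤ nw + n₀)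
    (hP : |P| ≤ n₀ * nD) (hQ : |Q| ≤ nD * ng) (hS : |S| ≤ n₀ * ng) :
    -((χ₁ + χ₀) * (χ₁ - χ₀) * P) + χ₁ ^ 2 * Q + (χ₁ + χ₀) * (χ₁ - χ₀) * S ≤
      (1 / 2) * (χ₁ * nD) ^ 2 + (13 / 2) * δ ^ 2 * n₀ ^ 2 + (1 / 2) * δ ^ 2 * nw ^ 2 + 2 * ng ^ 2 := by
  have hδ0 : 0 ≤ δ := (abs_nonneg _).trans hδ
  set e := χ₁ - χ₀ with he
  set a := χ₁ * nD with ha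
  have ha0 : 0 ≤ a := mul_nonneg h1 hnD
  have he2 : e ^ 2 ≤ δ ^ 2 := sq_le_sq' (by linarith [(abs_le.1 hδ).1]) (abs_le.1 hδ).2
  have heabs : |e| ≤ δ := hδ
  have hPabs := abs_le.1 hP
  have hQabs := abs_le.1 hQ
  have hSabs := abs_le.1 hS
  -- term 1: `−(χ₁+χ₀)·e·P = −2χ₁eP + e²P`
  have t1 : -((χ₁ + χ₀) * e * P) ≤ (1 / 4) * a ^ 2 + 4 * δ ^ 2 * n₀ ^ 2 + δ ^ 2 * ((3 / 2) * n₀ ^ 2 + (1 / 2) * nw ^ 2) := by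
    have e1 : -((χ₁ + χ₀) * e * P) = -(2 * e * (χ₁ * P)) + e ^ 2 * P := by rw [he]; ring
    rw [e1]
    have hχP : |χ₁ * P| ≤ n₀ * a := by
      rw [abs_mul, abs_of_nonneg h1, ha]
      calc χ₁ * |P| ≤ χ₁ * (n₀ * nD) := mul_le_mul_of_nonneg_left hP h1
        _ = n₀ * (χ₁ * nD) := by ring
    have i1 : -(2 * e * (χ₁ * P)) ≤ (1 / 4) * a ^ 2 + 4 * δ ^ 2 * n₀ ^ 2 := by
      have hb : |2 * e * (χ₁ * P)| ≤ 2 * (δ * n₀) * a := by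
        rw [abs_mul, abs_mul, abs_two]
        calc 2 * |e| * |χ₁ * P| ≤ 2 * δ * (n₀ * a) := by
              apply mul_le_mul (mul_le_mul_of_nonneg_left heabs (by norm_num)) hχP (abs_nonneg _) (by positivity)
          _ = 2 * (δ * n₀) * a := by ring
      have hy : 2 * (δ * n₀) * a ≤ (1 / 4) * a ^ 2 + 4 * (δ * n₀) ^ 2 := by nlinarith [sq_nonneg (a / 2 - 2 * (δ * n₀))]
      have := neg_abs_le (2 * e * (χ₁ * P))
      nlinarith [hb, hy]
    have i2 : e ^ 2 * P ≤ δ ^ 2 * ((3 / 2) * n₀ ^ 2 + (1 / 2) * nw ^ 2) := by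
      have hPb : P ≤ (3 / 2) * n₀ ^ 2 + (1 / 2) * nw ^ 2 := by
        have : n₀ * nD ≤ n₀ * (nw + n₀) := mul_le_mul_of_nonneg_left hDle hn₀
        nlinarith [hPabs.2, sq_nonneg (n₀ - nw)]
      have hPb' : |P| ≤ (3 / 2) * n₀ ^ 2 + (1 / 2) * nw ^ 2 := by
        have : n₀ * nD ≤ n₀ * (nw + n₀) := mul_le_mul_of_nonneg_left hDle hn₀
        nlinarith [hP, sq_nonneg (n₀ - nw)]
      calc e ^ 2 * P ≤ e ^ 2 * |P| := mul_le_mul_of_nonneg_left (le_abs_self _) (sq_nonneg _)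
        _ ≤ δ ^ 2 * ((3 / 2) * n₀ ^ 2 + (1 / 2) * nw ^ 2) := mul_le_mul he2 hPb' (abs_nonneg _) (sq_nonneg _)
    linarith
  -- term 2: `χ₁²Q ≤ χ₁·(χ₁ nD)·ng ≤ a·ng`
  have t2 : χ₁ ^ 2 * Q ≤ (1 / 4) * a ^ 2 + ng ^ 2 := by
    have i1 : χ₁ ^ 2 * Q ≤ a * ng := by
      calc χ₁ ^ 2 * Q ≤ χ₁ ^ 2 * |Q| := mul_le_mul_of_nonneg_left (le_abs_self _) (sq_nonneg _)
        _ ≤ χ₁ ^ 2 * (nD * ng) := mul_le_mul_of_nonneg_left hQ (sq_nonneg _)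
        _ = χ₁ * (a * ng) := by rw [ha]; ring
        _ ≤ 1 * (a * ng) := mul_le_mul_of_nonneg_right h1' (mul_nonneg ha0 hng)
        _ = a * ng := one_mul _
    nlinarith [sq_nonneg (a / 2 - ng)]
  -- term 3: `(χ₁+χ₀)eS ≤ 2δ n₀ ng`
  have t3 : (χ₁ + χ₀) * e * S ≤ δ ^ 2 * n₀ ^ 2 + ng ^ 2 := by
    have hb : |χ₁ + χ₀| ≤ 2 := abs_le.2 ⟨by linarith, by linarith⟩
    have hA : |e * S| ≤ δ * (n₀ * ng) := by
      rw [abs_mul]; exact mul_le_mul heabs hS (abs_nonneg _) hδ0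
    calc (χ₁ + χ₀) * e * S = (χ₁ + χ₀) * (e * S) := by ring
      _ ≤ |χ₁ + χ₀| * |e * S| := by rw [← abs_mul]; exact le_abs_self _
      _ ≤ 2 * (δ * (n₀ * ng)) := mul_le_mul hb hA (abs_nonneg _) (by norm_num)
      _ ≤ δ ^ 2 * n₀ ^ 2 + ng ^ 2 := by nlinarith [sq_nonneg (δ * n₀ - ng)]
  have esum : -((χ₁ + χ₀) * (χ₁ - χ₀) * P) + χ₁ ^ 2 * Q + (χ₁ + χ₀) * (χ₁ - χ₀) * S =
      -((χ₁ + χ₀) * e * P) + χ₁ ^ 2 * Q + (χ₁ + χ₀) * e * S := by rw [he]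
  rw [esum]
  linarith

/-! ## §3 ★★ The covariant Caccioppoli inequality -/

/-- ★★ **COVARIANT CACCIOPPOLI INEQUALITY ON `ℤ^d`, FLAT CONSTANTS.**  `V` a real inner-product space, `τ μ y : V ≃ₗᵢ[ℝ] V` any connection by linear
isometries, `κ ≥ 0`, `ρ ≥ 0`, `s ≥ 1`; if `u` solves `(Σ_μ D*_μD_μ + κ)u = Σ_μ D*_μ g_μ` at every site of `Q_{ρ+s}(z)` (expanded form in the hypothesis), then
`Σ_{y ∈ Q_ρ(z)} Σ_μ ‖τ μ y (u(y+e_μ)) − u(y)‖² ≤ (14d∕s²)·Σ_{Q_{ρ+s+2}(z)} ‖u‖² + 4·Σ_{Q_{ρ+s+1}(z)} Σ_μ ‖g_μ‖²` — test against `χ²u` with the cutoff of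
✓`exists_cutoff`, covariant summation by parts (§1), `scalar_young` bond by bond; the mass term has the good sign.  NO hypothesis on the size of the connection.
[folklore] [cite: Giaquinta1984, Ch. III §2 (2.3)–(2.4) p.77; Balaban1984PropagatorsII, (1.9) p.226] -/
theorem cov_caccioppoli (τ : Fin d → Zd d → (V ≃ₗᵢ[ℝ] V)) {κ : ℝ} (hκ : 0 ≤ κ) (u : Zd d → V) (g : Zd d → Fin d → V) (z : Zd d)
    {ρ s : ℤ} (hρ : 0 ≤ ρ) (hs : 1 ≤ s)
    (hEq : ∀ y ∈ box z (ρ + s),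
      (∑ μ, ((u y + u y) - (τ μ (y - unitVec μ)).symm (u (y - unitVec μ)) - τ μ y (u (y + unitVec μ)))) + κ • u y =
        ∑ μ, ((τ μ (y - unitVec μ)).symm (g (y - unitVec μ) μ) - g y μ)) :
    ∑ y ∈ box z ρ, ∑ μ, ‖τ μ y (u (y + unitVec μ)) - u y‖ ^ 2 ≤
      (14 * d / (s : ℝ) ^ 2) * ∑ y ∈ box z (ρ + s + 2), ‖u y‖ ^ 2 + 4 * ∑ y ∈ box z (ρ + s + 1), ∑ μ, ‖g y μ‖ ^ 2 := by
  classical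
  obtain ⟨χ, hχ0, hχ1, hχin, hχout, hχlip⟩ := exists_cutoff z hρ hs
  set R : ℤ := ρ + s + 1 with hR
  have hs0 : (0 : ℝ) < s := by exact_mod_cast (show (0 : ℤ) < s by linarith)
  set δ : ℝ := 1 / s with hδ
  have hδ0 : 0 ≤ δ := by positivity
  -- abbreviations: the covariant difference `D u y μ`
  set D : Zd d → Fin d → V := fun y μ => τ μ y (u (y + unitVec μ)) - u y with hD
  -- the test function `φ = χ²u` vanishes off `Q_{R-1}(z)`
  set φ : Zd d → V := fun y => (χ y ^ 2) • u y with hφ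
  have hφ0 : ∀ y ∉ box z (R - 1), φ y = 0 := by
    intro y hy
    have : χ y = 0 := hχout y (by rw [hR] at hy; simpa using hy)
    simp [hφ, this]
  -- the covariant Leibniz rule for the scalar cut-off
  have hDφ : ∀ (y : Zd d) (μ : Fin d), τ μ y (φ (y + unitVec μ)) - φ y =
      (χ (y + unitVec μ) ^ 2) • D y μ + ((χ (y + unitVec μ) + χ y) * (χ (y + unitVec μ) - χ y)) • u y := by
    intro y μ
    simp only [hφ, hD, LinearIsometryEquiv.map_smul, smul_sub]
    rw [show (χ (y + unitVec μ) + χ y) * (χ (y + unitVec μ) - χ y) = χ (y + unitVec μ) ^ 2 - χ y ^ 2 by ring, sub_smul]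
    abel
  -- summation by parts on both sides
  have hL := sum_inner_covLop τ κ φ u z R hφ0
  have hDv := sum_inner_covDvg τ φ g z R hφ0
  have hEq' : ∑ y ∈ box z R, ⟪φ y, (∑ μ, ((u y + u y) - (τ μ (y - unitVec μ)).symm (u (y - unitVec μ)) - τ μ y (u (y + unitVec μ)))) + κ • u y⟫_ℝ =
      ∑ y ∈ box z R, ⟪φ y, ∑ μ, ((τ μ (y - unitVec μ)).symm (g (y - unitVec μ) μ) - g y μ)⟫_ℝ := by
    refine Finset.sum_congr rfl fun y _ => ?_
    by_cases hy : y ∈ box z (R - 1)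
    · rw [hEq y (by rw [hR] at hy; simpa using hy)]
    · rw [hφ0 y hy, inner_zero_left, inner_zero_left]
  -- the mass term has the good sign
  have hmass : 0 ≤ κ * ∑ y ∈ box z R, ⟪φ y, u y⟫_ℝ := by
    apply mul_nonneg hκ
    refine Finset.sum_nonneg fun y _ => ?_
    simp only [hφ, real_inner_smul_left, real_inner_self_eq_norm_sq]
    positivity
  -- I ≤ Σ (pointwise RHS)
  have hI : ∑ y ∈ box z R, ∑ μ, (χ (y + unitVec μ) * ‖D y μ‖) ^ 2 ≤
      ∑ y ∈ box z R, ∑ μ, ((1 / 2) * (χ (y + unitVec μ) * ‖D y μ‖) ^ 2 + (13 / 2) * δ ^ 2 * ‖u y‖ ^ 2 +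
        (1 / 2) * δ ^ 2 * ‖u (y + unitVec μ)‖ ^ 2 + 2 * ‖g y μ‖ ^ 2) := by
    have h2 : ∑ y ∈ box z R, ∑ μ, ⟪τ μ y (φ (y + unitVec μ)) - φ y, D y μ⟫_ℝ + κ * ∑ y ∈ box z R, ⟪φ y, u y⟫_ℝ =
        ∑ y ∈ box z R, ∑ μ, ⟪τ μ y (φ (y + unitVec μ)) - φ y, g y μ⟫_ℝ := by rw [← hL, hEq', hDv]
    -- expand the pairings with the Leibniz rule
    have e1 : ∀ (y : Zd d) (μ : Fin d), ⟪τ μ y (φ (y + unitVec μ)) - φ y, D y μ⟫_ℝ =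
        (χ (y + unitVec μ) * ‖D y μ‖) ^ 2 + (χ (y + unitVec μ) + χ y) * (χ (y + unitVec μ) - χ y) * ⟪u y, D y μ⟫_ℝ := by
      intro y μ
      rw [hDφ, inner_add_left, real_inner_smul_left, real_inner_smul_left, real_inner_self_eq_norm_sq]
      ring
    have e2 : ∀ (y : Zd d) (μ : Fin d), ⟪τ μ y (φ (y + unitVec μ)) - φ y, g y μ⟫_ℝ =
        χ (y + unitVec μ) ^ 2 * ⟪D y μ, g y μ⟫_ℝ + (χ (y + unitVec μ) + χ y) * (χ (y + unitVec μ) - χ y) * ⟪u y, g y μ⟫_ℝ := by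
      intro y μ
      rw [hDφ, inner_add_left, real_inner_smul_left, real_inner_smul_left]
    simp_rw [e1, e2] at h2
    have h3 : ∑ y ∈ box z R, ∑ μ, (χ (y + unitVec μ) * ‖D y μ‖) ^ 2 ≤
        ∑ y ∈ box z R, ∑ μ, (-((χ (y + unitVec μ) + χ y) * (χ (y + unitVec μ) - χ y) * ⟪u y, D y μ⟫_ℝ) +
          χ (y + unitVec μ) ^ 2 * ⟪D y μ, g y μ⟫_ℝ + (χ (y + unitVec μ) + χ y) * (χ (y + unitVec μ) - χ y) * ⟪u y, g y μ⟫_ℝ) := by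
      have e4 : ∑ y ∈ box z R, ∑ μ, ((χ (y + unitVec μ) * ‖D y μ‖) ^ 2 +
            (χ (y + unitVec μ) + χ y) * (χ (y + unitVec μ) - χ y) * ⟪u y, D y μ⟫_ℝ) =
          ∑ y ∈ box z R, ∑ μ, (χ (y + unitVec μ) * ‖D y μ‖) ^ 2 +
            ∑ y ∈ box z R, ∑ μ, (χ (y + unitVec μ) + χ y) * (χ (y + unitVec μ) - χ y) * ⟪u y, D y μ⟫_ℝ := by
        rw [← Finset.sum_add_distrib]
        refine Finset.sum_congr rfl fun y _ => ?_
        rw [← Finset.sum_add_distrib]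
      have e3 : ∑ y ∈ box z R, ∑ μ, (-((χ (y + unitVec μ) + χ y) * (χ (y + unitVec μ) - χ y) * ⟪u y, D y μ⟫_ℝ) +
          χ (y + unitVec μ) ^ 2 * ⟪D y μ, g y μ⟫_ℝ + (χ (y + unitVec μ) + χ y) * (χ (y + unitVec μ) - χ y) * ⟪u y, g y μ⟫_ℝ) =
          ∑ y ∈ box z R, ∑ μ, (χ (y + unitVec μ) ^ 2 * ⟪D y μ, g y μ⟫_ℝ +
            (χ (y + unitVec μ) + χ y) * (χ (y + unitVec μ) - χ y) * ⟪u y, g y μ⟫_ℝ) -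
          ∑ y ∈ box z R, ∑ μ, (χ (y + unitVec μ) + χ y) * (χ (y + unitVec μ) - χ y) * ⟪u y, D y μ⟫_ℝ := by
        rw [← Finset.sum_sub_distrib]
        refine Finset.sum_congr rfl fun y _ => ?_
        rw [← Finset.sum_sub_distrib]
        refine Finset.sum_congr rfl fun μ _ => ?_
        ring
      rw [e4] at h2
      rw [e3]
      linarith
    refine h3.trans (Finset.sum_le_sum fun y _ => Finset.sum_le_sum fun μ _ => ?_)
    -- bond by bond: `scalar_young` with the Cauchy–Schwarz sizes
    have hnD : ‖D y μ‖ ≤ ‖u (y + unitVec μ)‖ + ‖u y‖ := by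
      calc ‖D y μ‖ = ‖τ μ y (u (y + unitVec μ)) - u y‖ := rfl
        _ ≤ ‖τ μ y (u (y + unitVec μ))‖ + ‖u y‖ := norm_sub_le _ _
        _ = ‖u (y + unitVec μ)‖ + ‖u y‖ := by rw [LinearIsometryEquiv.norm_map]
    have hP : |⟪u y, D y μ⟫_ℝ| ≤ ‖u y‖ * ‖D y μ‖ := abs_real_inner_le_norm _ _
    have hQ : |⟪D y μ, g y μ⟫_ℝ| ≤ ‖D y μ‖ * ‖g y μ‖ := abs_real_inner_le_norm _ _
    have hS : |⟪u y, g y μ⟫_ℝ| ≤ ‖u y‖ * ‖g y μ‖ := abs_real_inner_le_norm _ _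
    exact scalar_young (hχ0 y) (hχ1 y) (hχ0 (y + unitVec μ)) (hχ1 (y + unitVec μ)) (hχlip y μ) (norm_nonneg _)
      (norm_nonneg _) (norm_nonneg _) hnD hP hQ hS
  -- absorb
  have hI' : ∑ y ∈ box z R, ∑ μ, (χ (y + unitVec μ) * ‖D y μ‖) ^ 2 ≤
      13 * δ ^ 2 * ∑ y ∈ box z R, ∑ μ : Fin d, ‖u y‖ ^ 2 + δ ^ 2 * ∑ y ∈ box z R, ∑ μ, ‖u (y + unitVec μ)‖ ^ 2 +
        4 * ∑ y ∈ box z R, ∑ μ, ‖g y μ‖ ^ 2 := by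
    have e1 : ∑ y ∈ box z R, ∑ μ, ((1 / 2) * (χ (y + unitVec μ) * ‖D y μ‖) ^ 2 + (13 / 2) * δ ^ 2 * ‖u y‖ ^ 2 +
        (1 / 2) * δ ^ 2 * ‖u (y + unitVec μ)‖ ^ 2 + 2 * ‖g y μ‖ ^ 2) =
        (1 / 2) * ∑ y ∈ box z R, ∑ μ, (χ (y + unitVec μ) * ‖D y μ‖) ^ 2 + (13 / 2) * δ ^ 2 * ∑ y ∈ box z R, ∑ μ : Fin d, ‖u y‖ ^ 2 +
        (1 / 2) * δ ^ 2 * ∑ y ∈ box z R, ∑ μ, ‖u (y + unitVec μ)‖ ^ 2 + 2 * ∑ y ∈ box z R, ∑ μ, ‖g y μ‖ ^ 2 := by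
      simp only [Finset.sum_add_distrib, Finset.mul_sum]
    rw [e1] at hI
    linarith
  -- the pieces
  have hLHS : ∑ y ∈ box z ρ, ∑ μ, ‖τ μ y (u (y + unitVec μ)) - u y‖ ^ 2 ≤ ∑ y ∈ box z R, ∑ μ, (χ (y + unitVec μ) * ‖D y μ‖) ^ 2 := by
    have hsub : box z ρ ⊆ box z R := box_mono z (by rw [hR]; linarith)
    calc ∑ y ∈ box z ρ, ∑ μ, ‖τ μ y (u (y + unitVec μ)) - u y‖ ^ 2 = ∑ y ∈ box z ρ, ∑ μ, (χ (y + unitVec μ) * ‖D y μ‖) ^ 2 := by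
          refine Finset.sum_congr rfl fun y hy => Finset.sum_congr rfl fun μ _ => ?_
          rw [hχin _ (add_unitVec_mem_box hy μ), one_mul]
      _ ≤ ∑ y ∈ box z R, ∑ μ, (χ (y + unitVec μ) * ‖D y μ‖) ^ 2 :=
          Finset.sum_le_sum_of_subset_of_nonneg hsub fun _ _ _ => Finset.sum_nonneg fun _ _ => sq_nonneg _
  have hU1 : ∑ y ∈ box z R, ∑ μ : Fin d, ‖u y‖ ^ 2 ≤ d * ∑ y ∈ box z (ρ + s + 2), ‖u y‖ ^ 2 := by
    have e : ∑ y ∈ box z R, ∑ μ : Fin d, ‖u y‖ ^ 2 = d * ∑ y ∈ box z R, ‖u y‖ ^ 2 := by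
      rw [Finset.mul_sum]
      refine Finset.sum_congr rfl fun y _ => ?_
      rw [Finset.sum_const, Finset.card_univ, Fintype.card_fin, nsmul_eq_mul]
    rw [e]
    exact mul_le_mul_of_nonneg_left (Finset.sum_le_sum_of_subset_of_nonneg (box_mono z (by rw [hR]; linarith))
      fun _ _ _ => sq_nonneg _) (Nat.cast_nonneg d)
  have hU2 : ∑ y ∈ box z R, ∑ μ, ‖u (y + unitVec μ)‖ ^ 2 ≤ d * ∑ y ∈ box z (ρ + s + 2), ‖u y‖ ^ 2 := by
    rw [Finset.sum_comm]
    have : ∀ μ : Fin d, ∑ y ∈ box z R, ‖u (y + unitVec μ)‖ ^ 2 ≤ ∑ y ∈ box z (ρ + s + 2), ‖u y‖ ^ 2 := by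
      intro μ
      rw [sum_box_add_right (fun y => ‖u y‖ ^ 2)]
      refine Finset.sum_le_sum_of_subset_of_nonneg (box_subset_box fun i => ?_) fun _ _ _ => sq_nonneg _
      simp only [Pi.add_apply, add_sub_cancel_left]
      rw [hR]
      linarith [abs_unitVec_apply_le μ i]
    calc ∑ μ, ∑ y ∈ box z R, ‖u (y + unitVec μ)‖ ^ 2 ≤ ∑ μ : Fin d, ∑ y ∈ box z (ρ + s + 2), ‖u y‖ ^ 2 := Finset.sum_le_sum fun μ _ => this μ
      _ = d * ∑ y ∈ box z (ρ + s + 2), ‖u y‖ ^ 2 := by rw [Finset.sum_const, Finset.card_univ, Fintype.card_fin, nsmul_eq_mul]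
  have hG : ∑ y ∈ box z R, ∑ μ, ‖g y μ‖ ^ 2 = ∑ y ∈ box z (ρ + s + 1), ∑ μ, ‖g y μ‖ ^ 2 := by rw [hR]
  have hUnn : 0 ≤ ∑ y ∈ box z (ρ + s + 2), ‖u y‖ ^ 2 := Finset.sum_nonneg fun _ _ => sq_nonneg _
  have hδ2 : δ ^ 2 = 1 / (s : ℝ) ^ 2 := by rw [hδ]; field_simp
  calc ∑ y ∈ box z ρ, ∑ μ, ‖τ μ y (u (y + unitVec μ)) - u y‖ ^ 2 ≤ ∑ y ∈ box z R, ∑ μ, (χ (y + unitVec μ) * ‖D y μ‖) ^ 2 := hLHS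
    _ ≤ 13 * δ ^ 2 * (d * ∑ y ∈ box z (ρ + s + 2), ‖u y‖ ^ 2) + δ ^ 2 * (d * ∑ y ∈ box z (ρ + s + 2), ‖u y‖ ^ 2) +
        4 * ∑ y ∈ box z (ρ + s + 1), ∑ μ, ‖g y μ‖ ^ 2 := by
        rw [← hG]
        have a1 := mul_le_mul_of_nonneg_left hU1 (by positivity : (0:ℝ) ≤ 13 * δ ^ 2)
        have a2 := mul_le_mul_of_nonneg_left hU2 (by positivity : (0:ℝ) ≤ δ ^ 2)
        linarith
    _ = (14 * d / (s : ℝ) ^ 2) * ∑ y ∈ box z (ρ + s + 2), ‖u y‖ ^ 2 + 4 * ∑ y ∈ box z (ρ + s + 1), ∑ μ, ‖g y μ‖ ^ 2 := by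
        rw [hδ2]; ring

/-- ★ **COVARIANT CACCIOPPOLI FOR COVARIANTLY `κ`-HARMONIC FUNCTIONS** (`g = 0`): `Σ_{Q_ρ} Σ_μ ‖D_μh‖² ≤ (14d∕s²)·Σ_{Q_{ρ+s+2}} ‖h‖²`.
[folklore] [cite: Giaquinta1984, Ch. III §2 (2.4) p.77] -/
theorem cov_caccioppoli_harmonic (τ : Fin d → Zd d → (V ≃ₗᵢ[ℝ] V)) {κ : ℝ} (hκ : 0 ≤ κ) (h : Zd d → V) (z : Zd d) {ρ s : ℤ} (hρ : 0 ≤ ρ)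
    (hs : 1 ≤ s)
    (hEq : ∀ y ∈ box z (ρ + s),
      (∑ μ, ((h y + h y) - (τ μ (y - unitVec μ)).symm (h (y - unitVec μ)) - τ μ y (h (y + unitVec μ)))) + κ • h y = 0) :
    ∑ y ∈ box z ρ, ∑ μ, ‖τ μ y (h (y + unitVec μ)) - h y‖ ^ 2 ≤ (14 * d / (s : ℝ) ^ 2) * ∑ y ∈ box z (ρ + s + 2), ‖h y‖ ^ 2 := by
  have := cov_caccioppoli τ hκ h (fun _ _ => 0) z hρ hs (fun y hy => by rw [hEq y hy]; simp)
  simpa using this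

end Summit.QuantumFields.YangMills.Theorems.PoincareLipschitzCovariantCaccioppoli

end
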